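import Summits.NavierStokesRegularity.NavierStokesRegularity.Theorems.ScaledTopAlignmentTypeIBlowupWindowPortraitEverywhere
import Summits.NavierStokesRegularity.NavierStokesRegularity.Theorems.ScaledTopAlignmentAprioriMostTimesBulkAlignmentNearMaxOfUniversalLaws
import Summits.NavierStokesRegularity.NavierStokesRegularity.Theorems.TypeILiouvilleTypeIliouvilleNoTypeIIDoorCalculus
import HarnessLib

/-!
# Route `ScaledTopAlignment`, crux W3ᵐᵗ = `AprioriMostTimesBulkAlignment` (stmt-NavierStokesRegularity-19551),
# registered line `nearmax` (open stub `stub_nearMaxMostTimes`): the WEAKEST killable form of the universal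
# amplified-window law — ONE aligned near-max window per good time suffices

The planner's law UAW (ROUND-10 `UniversalAmplifiedWindowAlignment`; tree glue
`nearMaxMostTimesDoor_of_universalAmplifiedWindowAlignment`) demands the aligned-window clause at EVERY amplified
`q`-near-maximal point of every good time. Since the volume-currency Type-I portrait now holds AT EVERY late rate point
(`typeI_uniform_window_bulk_misalignment`, `ScaledTopAlignmentTypeIBlowupWindowPortraitEverywhere`), a far weaker
law already excludes Type-I blow-up: it is enough that, outside exceptional times of final density `≤ θ < 1`, at every
time carrying an `A·m₀`-amplified `q`-near-maximal point SOME such point has an `(ε, δ)`-aligned `λ₀`-top window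
(«∃ x» instead of «∀ x»). This file states that law inline (UAW∃, same universal quantifier pattern
`∃ λ₀ R₀ θ ∀ q ε δ ∃ A` as UAW) and proves:

* `false_of_someAlignedRateWindows_typeI` — per solution: the Type-I rate at `T`, no smooth extension, and, for the
  portrait's `(ε, δ)`, aligned windows at rate points at times arbitrarily close to `T` are incompatible;
* `threadingFluxTarget_of_universalSomeAlignedWindowLaw` — **UAW∃ ⇒ `ThreadingFlux.Target`** (1217);
* `aprioriMostTimesBulkAlignment_of_universalSomeAlignedWindowLaw_of_typeIIResidue` — ∧ R_II ⇒ the crux by name;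
* `nearMaxMostTimesDoor_of_universalSomeAlignedWindowLaw_of_typeIIResidue` — ∧ R_II ⇒ the registered STUB 1 literally;
* `navierStokesRegularity_of_universalSomeAlignedWindowLaw_of_noTypeII` — ∧ NoTypeII ⇒ Clay (A);
* `universalSomeAlignedWindowLaw_of_universalAmplifiedWindowAlignment` — UAW ⇒ UAW∃ (so this glue subsumes LAW-T).

Design consequence for the cell's instrument (stated, not used): a certified statistic refuting UAW∃ must show that at
a positive final-density set of times NO amplified near-max window is aligned — presence of misalignment at ALL
near-max points, not merely at some. hard core evaded: none — UAW∃ IMPLIES Target (1217); NoTypeII (0056) is the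
residual. WHAT THIS IS NOT: not NS regularity and not a proof of UAW∃ or of the stub. [folklore]
-/

noncomputable section

-- the summit and its single sub-problem share the name (CONVENTIONS §1), as in every Theorems file
set_option linter.dupNamespace false

open MeasureTheory Set Function Filter Topology Metric
open scoped RealInnerProductSpace ENNReal
open Literature.Analysis Literature.Analysis.FluidPDE

namespace Summit.NavierStokesRegularity.NavierStokesRegularity.Theorems

/-! ### Per solution: aligned rate windows arbitrarily late are incompatible with the Type-I rate -/

/-- **One aligned late rate window per request kills Type I.** For a classical Leray–Hopf solution from a rapidly
decaying datum with the Type-I rate at `T`, and `λ₀ < 1`, `R₀ > 0`, `κ > 0`: it is impossible that for every `ε, δ > 0`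
and every `t₁ < T` some rate point `(t, x)`, `t ∈ [t₁, T)`, `κ/(T − t) ≤ |ω(t,x)|`, has an `ε`-misaligned `λ₀`-top part of
its `R₀ℓ`-window of volume `≤ δℓ³` — by the every-point portrait `typeI_uniform_window_bulk_misalignment`. [folklore] -/
theorem false_of_someAlignedRateWindows_typeI {ν T : ℝ} (hν : 0 < ν) (hT : 0 < T)
    {u : ℝ → EuclideanSpace ℝ (Fin 3) → EuclideanSpace ℝ (Fin 3)} {p : ℝ → EuclideanSpace ℝ (Fin 3) → ℝ}
    (hsol : IsClassicalNSSolutionOn (Ico 0 T) ν 0 u p) (hLH : IsLerayHopfOn T ν 0 (u 0) u)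
    (hdec : HasRapidSpatialDecay (u 0)) (hI : IsTypeIBlowup u T)
    {κ lam0 R0 : ℝ} (hκ : 0 < κ) (hlam1 : lam0 < 1) (hR0 : 0 < R0)
    (hal : ∀ ε : ℝ, 0 < ε → ∀ δ : ℝ, 0 < δ → ∀ t₁ ∈ Ico 0 T, ∃ t ∈ Ico t₁ T, ∃ x : EuclideanSpace ℝ (Fin 3),
      κ / (T - t) ≤ ‖curl (u t) x‖ ∧
        volume {y : EuclideanSpace ℝ (Fin 3) | lam0 * ‖curl (u t) x‖ ≤ ‖curl (u t) y‖ ∧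
            ‖x - y‖ ≤ R0 * Real.sqrt (ν / ‖curl (u t) x‖) ∧
            ε < Real.sqrt (1 - (inner ℝ (‖curl (u t) x‖⁻¹ • curl (u t) x)
              (‖curl (u t) y‖⁻¹ • curl (u t) y)) ^ 2)}
          ≤ ENNReal.ofReal (δ * Real.sqrt (ν / ‖curl (u t) x‖) ^ 3)) : False := by
  obtain ⟨ε, hε, δ, hδ, t₁, ht₁, hF⟩ := typeI_uniform_window_bulk_misalignment hν hT hsol hLH hdec hI hκ hlam1 hR0
  obtain ⟨t, ht, x, hrate, hle⟩ := hal ε hε δ hδ t₁ ht₁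
  exact absurd hle (not_le.2 (hF t ht x hrate))

/-! ### The law UAW∃ and its consequences -/

/-- Exceptional times of final density `≤ θ < 1` miss some point of every late interval: if
`vol(E ∩ (T−h, T)) ≤ θh` for `0 < h < h₀`, then for every `t⋆ < T` there is `t ∈ [t⋆, T) ∖ E` (with `0 ≤ t⋆`). [folklore] -/
theorem exists_late_notMem_of_finalDensity {T θ : ℝ} (hθ : θ < 1) {E : Set ℝ}
    (hE : ∃ h0 : ℝ, 0 < h0 ∧ ∀ h : ℝ, 0 < h → h < h0 → volume (E ∩ Set.Ioo (T - h) T) ≤ ENNReal.ofReal (θ * h))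
    {tstar : ℝ} (htstar : tstar < T) : ∃ t ∈ Ico tstar T, t ∉ E := by
  obtain ⟨h0, hh0, hE⟩ := hE
  set h : ℝ := min (h0 / 2) (T - tstar) with hh
  have hhpos : 0 < h := lt_min (by linarith) (sub_pos.2 htstar)
  have hhlt : h < h0 := lt_of_le_of_lt (min_le_left _ _) (by linarith)
  have hhle : h ≤ T - tstar := min_le_right _ _
  by_contra hno
  push Not at hno
  -- then `(T - h, T) ⊆ E`
  have hsub : Ioo (T - h) T ⊆ E ∩ Ioo (T - h) T := fun t ht =>
    ⟨hno t ⟨by linarith [ht.1], ht.2⟩, ht⟩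
  have h1 : ENNReal.ofReal h ≤ ENNReal.ofReal (θ * h) := by
    calc ENNReal.ofReal h = volume (Ioo (T - h) T) := by rw [Real.volume_Ioo]; ring_nf
      _ ≤ volume (E ∩ Ioo (T - h) T) := measure_mono hsub
      _ ≤ ENNReal.ofReal (θ * h) := hE h hhpos hhlt
  have h2 : θ * h < h := by nlinarith
  rcases ENNReal.ofReal_le_ofReal_iff'.1 h1 with h3 | h3
  · exact absurd h3 (not_le.2 h2)
  · exact absurd h3 (not_le.2 hhpos)

/-- **UAW∃ ⇒ the hard core `ThreadingFlux.Target`.** The inline hypothesis is the weak law: universal `λ₀ < 1`,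
`R₀ > 0`, `θ < 1`; per `(q, ε, δ)` a universal gate `A`; in every classical Leray–Hopf flow from rapidly decaying data
with `‖curl u₀‖ ≤ m₀`, outside exceptional times of final density `≤ θ`, at every time carrying an `A·m₀`-amplified
`q`-near-maximal point, SOME such point has an `ε`-misaligned `λ₀`-top part of its `R₀ℓ`-window of volume `≤ δℓ³`.
Per solution with a Type-I first blow-up: late times outside `E` exist (`exists_late_notMem_of_finalDensity`),
amplified `q`-near-maximal points exist there (`q < 1`, lower vorticity rate), they are rate points (`κ = c/4` for `q = 1/2`), and the
every-point portrait forbids their alignment (`false_of_someAlignedRateWindows_typeI`). [folklore] -/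
theorem threadingFluxTarget_of_universalSomeAlignedWindowLaw
    (hL : ∃ lam0 : ℝ, lam0 < 1 ∧ ∃ R0 : ℝ, 0 < R0 ∧ ∃ θ : ℝ, θ < 1 ∧
      ∀ q : ℝ, 0 < q → ∀ ε : ℝ, 0 < ε → ∀ δ : ℝ, 0 < δ → ∃ A : ℝ, 0 < A ∧
        ∀ (ν T : ℝ), 0 < ν → 0 < T → ∀ (u : ℝ → EuclideanSpace ℝ (Fin 3) → EuclideanSpace ℝ (Fin 3))
          (p : ℝ → EuclideanSpace ℝ (Fin 3) → ℝ),
          IsClassicalNSSolutionOn (Set.Ico 0 T) ν 0 u p → IsLerayHopfOn T ν 0 (u 0) u → HasRapidSpatialDecay (u 0) →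
          ∀ m0 : ℝ, 0 < m0 → (∀ x, ‖curl (u 0) x‖ ≤ m0) →
            ∃ E : Set ℝ, (∃ h0 : ℝ, 0 < h0 ∧ ∀ h : ℝ, 0 < h → h < h0 →
                volume (E ∩ Set.Ioo (T - h) T) ≤ ENNReal.ofReal (θ * h)) ∧
              ∀ t ∈ Set.Ico 0 T, t ∉ E →
                (∃ x : EuclideanSpace ℝ (Fin 3), A * m0 ≤ ‖curl (u t) x‖ ∧
                  ∀ x' : EuclideanSpace ℝ (Fin 3), q * ‖curl (u t) x'‖ ≤ ‖curl (u t) x‖) →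
                ∃ x : EuclideanSpace ℝ (Fin 3), A * m0 ≤ ‖curl (u t) x‖ ∧
                  (∀ x' : EuclideanSpace ℝ (Fin 3), q * ‖curl (u t) x'‖ ≤ ‖curl (u t) x‖) ∧
                  volume {y : EuclideanSpace ℝ (Fin 3) | lam0 * ‖curl (u t) x‖ ≤ ‖curl (u t) y‖ ∧
                      ‖x - y‖ ≤ R0 * Real.sqrt (ν / ‖curl (u t) x‖) ∧
                      ε < Real.sqrt (1 - (inner ℝ (‖curl (u t) x‖⁻¹ • curl (u t) x)
                        (‖curl (u t) y‖⁻¹ • curl (u t) y)) ^ 2)}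
                    ≤ ENNReal.ofReal (δ * Real.sqrt (ν / ‖curl (u t) x‖) ^ 3)) :
    Summit.NavierStokesRegularity.NavierStokesRegularity.Theses.ThreadingFlux.Target := by
  intro ν T hν hT u p hcl hLH hdec hI
  by_contra hext
  obtain ⟨lam0, hlam1, R0, hR0, θ, hθ, hfam⟩ := hL
  obtain ⟨m0, hm0, hbd⟩ := exists_bound_curl_of_rapidDecay hdec
  -- the two-sided vorticity rate; near-max fraction `q = 1/2`, rate floor `κ = c/4`
  obtain ⟨Cω, tω, htω, hup⟩ := TubeAlternative.AnalyticPropagation.upper_vorticity_rate hν hT hcl hLH hdec hI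
  obtain ⟨c, hc, tc, htc, hlow⟩ :=
    TubeAlternative.AnalyticPropagation.lower_vorticity_rate hν hT ⟨hcl, hext⟩ hLH hdec hI
  have hκ : 0 < (1 / 4 : ℝ) * c := by positivity
  refine false_of_someAlignedRateWindows_typeI hν hT hcl hLH hdec hI hκ hlam1 hR0 fun ε hε δ hδ t₁ ht₁ => ?_
  obtain ⟨A, hA, hA'⟩ := hfam (1 / 2) (by norm_num) ε hε δ hδ
  obtain ⟨E, hE, hgood⟩ := hA' ν T hν hT u p hcl hLH hdec m0 hm0 hbd
  -- a late time outside `E`, after `t₁, tω, tc` and after the amplification threshold `c/(T−t) ≥ 2 A m₀`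
  set tstar : ℝ := max (max (max t₁ tω) tc) (T - c / (2 * (A * m0))) with htstar
  have hq0 : 0 < c / (2 * (A * m0)) := by positivity
  have htstarT : tstar < T := max_lt (max_lt (max_lt ht₁.2 htω.2) htc.2) (by linarith)
  obtain ⟨t, ht, htE⟩ := exists_late_notMem_of_finalDensity (T := T) hθ hE htstarT
  have ht₁t : t₁ ≤ t := (((le_max_left _ _).trans (le_max_left _ _)).trans (le_max_left _ _)).trans ht.1
  have htωt : t ∈ Ico tω T := ⟨(((le_max_right _ _).trans (le_max_left _ _)).trans (le_max_left _ _)).trans ht.1, ht.2⟩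
  have htct : t ∈ Ico tc T := ⟨((le_max_right _ _).trans (le_max_left _ _)).trans ht.1, ht.2⟩
  have ht0T : t ∈ Ico 0 T := ⟨ht₁.1.trans ht₁t, ht.2⟩
  have hTt : 0 < T - t := sub_pos.2 ht.2
  -- the slice supremum and an amplified `1/2`-near-maximal point
  have hbdd : BddAbove (range fun z => ‖curl (u t) z‖) :=
    ⟨Cω / (T - t), by rintro _ ⟨z, rfl⟩; exact hup t htωt z⟩
  obtain ⟨x', hx'⟩ := hlow t htct
  have hs_ge : c / (T - t) ≤ ⨆ z, ‖curl (u t) z‖ := hx'.trans (le_ciSup hbdd x')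
  have hs0 : 0 < ⨆ z, ‖curl (u t) z‖ := lt_of_lt_of_le (div_pos hc hTt) hs_ge
  have hlt : (1 / 2 : ℝ) * (⨆ z, ‖curl (u t) z‖) < ⨆ z, ‖curl (u t) z‖ := by linarith
  obtain ⟨z, hz⟩ : ∃ z, (1 / 2 : ℝ) * (⨆ z, ‖curl (u t) z‖) < ‖curl (u t) z‖ := exists_lt_of_lt_ciSup hlt
  have hznear : ∀ x'' : EuclideanSpace ℝ (Fin 3), (1 / 2 : ℝ) * ‖curl (u t) x''‖ ≤ ‖curl (u t) z‖ := fun x'' =>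
    (mul_le_mul_of_nonneg_left (le_ciSup hbdd x'') (by norm_num)).trans hz.le
  have hamp : A * m0 ≤ ‖curl (u t) z‖ := by
    -- `c/(T−t) ≥ 2 A m₀` since `T − t ≤ c/(2 A m₀)`
    have h1 : T - t ≤ c / (2 * (A * m0)) := by
      have := le_max_right (max (max t₁ tω) tc) (T - c / (2 * (A * m0))); rw [← htstar] at this; linarith [ht.1]
    have hAm0 : 0 < A * m0 := by positivity
    have h2 : 2 * (A * m0) ≤ c / (T - t) := by
      rw [le_div_iff₀ hTt]
      calc 2 * (A * m0) * (T - t) ≤ 2 * (A * m0) * (c / (2 * (A * m0))) :=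
            mul_le_mul_of_nonneg_left h1 (by positivity)
        _ = c := by field_simp
    linarith [hs_ge, hz.le]
  obtain ⟨x, hxamp, hxnear, hxle⟩ := hgood t ht0T htE ⟨z, hamp, hznear⟩
  -- the good point is a rate point with `κ = c/4`
  refine ⟨t, ⟨ht₁t, ht.2⟩, x, ?_, hxle⟩
  calc 1 / 4 * c / (T - t) = (1 / 4 : ℝ) * (c / (T - t)) := by ring
    _ ≤ (1 / 4 : ℝ) * ⨆ z, ‖curl (u t) z‖ := mul_le_mul_of_nonneg_left hs_ge (by norm_num)
    _ ≤ (1 / 2 : ℝ) * ‖curl (u t) z‖ := by linarith [hz.le]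
    _ ≤ ‖curl (u t) x‖ := by
        have := hxnear z
        linarith

/-- **UAW∃ ∧ R_II ⇒ the CRUX by name** (`aprioriMostTimesBulkAlignment_iff_target_and_typeII`). [folklore] -/
theorem aprioriMostTimesBulkAlignment_of_universalSomeAlignedWindowLaw_of_typeIIResidue
    (hL : ∃ lam0 : ℝ, lam0 < 1 ∧ ∃ R0 : ℝ, 0 < R0 ∧ ∃ θ : ℝ, θ < 1 ∧
      ∀ q : ℝ, 0 < q → ∀ ε : ℝ, 0 < ε → ∀ δ : ℝ, 0 < δ → ∃ A : ℝ, 0 < A ∧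
        ∀ (ν T : ℝ), 0 < ν → 0 < T → ∀ (u : ℝ → EuclideanSpace ℝ (Fin 3) → EuclideanSpace ℝ (Fin 3))
          (p : ℝ → EuclideanSpace ℝ (Fin 3) → ℝ),
          IsClassicalNSSolutionOn (Set.Ico 0 T) ν 0 u p → IsLerayHopfOn T ν 0 (u 0) u → HasRapidSpatialDecay (u 0) →
          ∀ m0 : ℝ, 0 < m0 → (∀ x, ‖curl (u 0) x‖ ≤ m0) →
            ∃ E : Set ℝ, (∃ h0 : ℝ, 0 < h0 ∧ ∀ h : ℝ, 0 < h → h < h0 →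
                volume (E ∩ Set.Ioo (T - h) T) ≤ ENNReal.ofReal (θ * h)) ∧
              ∀ t ∈ Set.Ico 0 T, t ∉ E →
                (∃ x : EuclideanSpace ℝ (Fin 3), A * m0 ≤ ‖curl (u t) x‖ ∧
                  ∀ x' : EuclideanSpace ℝ (Fin 3), q * ‖curl (u t) x'‖ ≤ ‖curl (u t) x‖) →
                ∃ x : EuclideanSpace ℝ (Fin 3), A * m0 ≤ ‖curl (u t) x‖ ∧
                  (∀ x' : EuclideanSpace ℝ (Fin 3), q * ‖curl (u t) x'‖ ≤ ‖curl (u t) x‖) ∧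
                  volume {y : EuclideanSpace ℝ (Fin 3) | lam0 * ‖curl (u t) x‖ ≤ ‖curl (u t) y‖ ∧
                      ‖x - y‖ ≤ R0 * Real.sqrt (ν / ‖curl (u t) x‖) ∧
                      ε < Real.sqrt (1 - (inner ℝ (‖curl (u t) x‖⁻¹ • curl (u t) x)
                        (‖curl (u t) y‖⁻¹ • curl (u t) y)) ^ 2)}
                    ≤ ENNReal.ofReal (δ * Real.sqrt (ν / ‖curl (u t) x‖) ^ 3))
    (hRII : ∀ (ν T : ℝ), 0 < ν → 0 < T → ∀ (u : ℝ → EuclideanSpace ℝ (Fin 3) → EuclideanSpace ℝ (Fin 3))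
        (p : ℝ → EuclideanSpace ℝ (Fin 3) → ℝ),
        IsClassicalNSSolutionOn (Set.Ico 0 T) ν 0 u p → IsLerayHopfOn T ν 0 (u 0) u →
        HasRapidSpatialDecay (u 0) → ¬ HasSmoothExtensionPast ν 0 u T → ¬ IsTypeIBlowup u T →
        ∃ lam0 : ℝ, lam0 < 1 ∧ ∃ R0 : ℝ, 0 < R0 ∧ ∃ θ : ℝ, θ < 1 ∧ ∀ κ : ℝ, 0 < κ → ∀ ε : ℝ, 0 < ε →
          ∀ δ : ℝ, 0 < δ → ∃ M : ℝ, 0 < M ∧ ∃ E : Set ℝ,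
            (∃ h0 : ℝ, 0 < h0 ∧ ∀ h : ℝ, 0 < h → h < h0 →
              volume (E ∩ Set.Ioo (T - h) T) ≤ ENNReal.ofReal (θ * h)) ∧
            ∀ t ∈ Set.Ico 0 T, t ∉ E → ∀ x : EuclideanSpace ℝ (Fin 3), M ≤ ‖curl (u t) x‖ →
              κ / (T - t) ≤ ‖curl (u t) x‖ →
              volume {y : EuclideanSpace ℝ (Fin 3) | lam0 * ‖curl (u t) x‖ ≤ ‖curl (u t) y‖ ∧
                  ‖x - y‖ ≤ R0 * Real.sqrt (ν / ‖curl (u t) x‖) ∧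
                  ε < Real.sqrt (1 - (inner ℝ (‖curl (u t) x‖⁻¹ • curl (u t) x)
                    (‖curl (u t) y‖⁻¹ • curl (u t) y)) ^ 2)}
                ≤ ENNReal.ofReal (δ * Real.sqrt (ν / ‖curl (u t) x‖) ^ 3)) :
    Summit.NavierStokesRegularity.NavierStokesRegularity.Theses.ScaledTopAlignment.AprioriMostTimesBulkAlignment :=
  aprioriMostTimesBulkAlignment_iff_target_and_typeII.mpr
    ⟨threadingFluxTarget_of_universalSomeAlignedWindowLaw hL, hRII⟩

/-- **UAW∃ ∧ R_II ⇒ STUB 1 of line `nearmax`, literally** (the conclusion is the signature of the registered stub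
`Nearmax.stub_nearMaxMostTimes`; via `nearMaxMostTimesBulkAlignment_of_aprioriMostTimesBulkAlignment`). [folklore] -/
theorem nearMaxMostTimesDoor_of_universalSomeAlignedWindowLaw_of_typeIIResidue
    (hL : ∃ lam0 : ℝ, lam0 < 1 ∧ ∃ R0 : ℝ, 0 < R0 ∧ ∃ θ : ℝ, θ < 1 ∧
      ∀ q : ℝ, 0 < q → ∀ ε : ℝ, 0 < ε → ∀ δ : ℝ, 0 < δ → ∃ A : ℝ, 0 < A ∧
        ∀ (ν T : ℝ), 0 < ν → 0 < T → ∀ (u : ℝ → EuclideanSpace ℝ (Fin 3) → EuclideanSpace ℝ (Fin 3))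
          (p : ℝ → EuclideanSpace ℝ (Fin 3) → ℝ),
          IsClassicalNSSolutionOn (Set.Ico 0 T) ν 0 u p → IsLerayHopfOn T ν 0 (u 0) u → HasRapidSpatialDecay (u 0) →
          ∀ m0 : ℝ, 0 < m0 → (∀ x, ‖curl (u 0) x‖ ≤ m0) →
            ∃ E : Set ℝ, (∃ h0 : ℝ, 0 < h0 ∧ ∀ h : ℝ, 0 < h → h < h0 →
                volume (E ∩ Set.Ioo (T - h) T) ≤ ENNReal.ofReal (θ * h)) ∧
              ∀ t ∈ Set.Ico 0 T, t ∉ E →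
                (∃ x : EuclideanSpace ℝ (Fin 3), A * m0 ≤ ‖curl (u t) x‖ ∧
                  ∀ x' : EuclideanSpace ℝ (Fin 3), q * ‖curl (u t) x'‖ ≤ ‖curl (u t) x‖) →
                ∃ x : EuclideanSpace ℝ (Fin 3), A * m0 ≤ ‖curl (u t) x‖ ∧
                  (∀ x' : EuclideanSpace ℝ (Fin 3), q * ‖curl (u t) x'‖ ≤ ‖curl (u t) x‖) ∧
                  volume {y : EuclideanSpace ℝ (Fin 3) | lam0 * ‖curl (u t) x‖ ≤ ‖curl (u t) y‖ ∧
                      ‖x - y‖ ≤ R0 * Real.sqrt (ν / ‖curl (u t) x‖) ∧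
                      ε < Real.sqrt (1 - (inner ℝ (‖curl (u t) x‖⁻¹ • curl (u t) x)
                        (‖curl (u t) y‖⁻¹ • curl (u t) y)) ^ 2)}
                    ≤ ENNReal.ofReal (δ * Real.sqrt (ν / ‖curl (u t) x‖) ^ 3))
    (hRII : ∀ (ν T : ℝ), 0 < ν → 0 < T → ∀ (u : ℝ → EuclideanSpace ℝ (Fin 3) → EuclideanSpace ℝ (Fin 3))
        (p : ℝ → EuclideanSpace ℝ (Fin 3) → ℝ),
        IsClassicalNSSolutionOn (Set.Ico 0 T) ν 0 u p → IsLerayHopfOn T ν 0 (u 0) u →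
        HasRapidSpatialDecay (u 0) → ¬ HasSmoothExtensionPast ν 0 u T → ¬ IsTypeIBlowup u T →
        ∃ lam0 : ℝ, lam0 < 1 ∧ ∃ R0 : ℝ, 0 < R0 ∧ ∃ θ : ℝ, θ < 1 ∧ ∀ κ : ℝ, 0 < κ → ∀ ε : ℝ, 0 < ε →
          ∀ δ : ℝ, 0 < δ → ∃ M : ℝ, 0 < M ∧ ∃ E : Set ℝ,
            (∃ h0 : ℝ, 0 < h0 ∧ ∀ h : ℝ, 0 < h → h < h0 →
              volume (E ∩ Set.Ioo (T - h) T) ≤ ENNReal.ofReal (θ * h)) ∧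
            ∀ t ∈ Set.Ico 0 T, t ∉ E → ∀ x : EuclideanSpace ℝ (Fin 3), M ≤ ‖curl (u t) x‖ →
              κ / (T - t) ≤ ‖curl (u t) x‖ →
              volume {y : EuclideanSpace ℝ (Fin 3) | lam0 * ‖curl (u t) x‖ ≤ ‖curl (u t) y‖ ∧
                  ‖x - y‖ ≤ R0 * Real.sqrt (ν / ‖curl (u t) x‖) ∧
                  ε < Real.sqrt (1 - (inner ℝ (‖curl (u t) x‖⁻¹ • curl (u t) x)
                    (‖curl (u t) y‖⁻¹ • curl (u t) y)) ^ 2)}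
                ≤ ENNReal.ofReal (δ * Real.sqrt (ν / ‖curl (u t) x‖) ^ 3)) :
    ∀ (ν T : ℝ), 0 < ν → 0 < T → ∀ (u : ℝ → EuclideanSpace ℝ (Fin 3) → EuclideanSpace ℝ (Fin 3))
      (p : ℝ → EuclideanSpace ℝ (Fin 3) → ℝ), IsClassicalNSSolutionOn (Set.Ico 0 T) ν 0 u p →
      IsLerayHopfOn T ν 0 (u 0) u → HasRapidSpatialDecay (u 0) →
      ∃ lam0 : ℝ, lam0 < 1 ∧ ∃ R0 : ℝ, 0 < R0 ∧ ∃ θ : ℝ, θ < 1 ∧ ∀ κ : ℝ, 0 < κ → ∀ q : ℝ, 0 < q →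
        ∀ ε : ℝ, 0 < ε → ∀ δ : ℝ, 0 < δ → ∃ M : ℝ, 0 < M ∧ ∃ E : Set ℝ,
        (∃ h0 : ℝ, 0 < h0 ∧ ∀ h : ℝ, 0 < h → h < h0 →
          MeasureTheory.volume (E ∩ Set.Ioo (T - h) T) ≤ ENNReal.ofReal (θ * h)) ∧
        ∀ t ∈ Set.Ico 0 T, t ∉ E → ∀ x : EuclideanSpace ℝ (Fin 3), M ≤ ‖curl (u t) x‖ →
        κ / (T - t) ≤ ‖curl (u t) x‖ → (∀ x' : EuclideanSpace ℝ (Fin 3), q * ‖curl (u t) x'‖ ≤ ‖curl (u t) x‖) →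
          MeasureTheory.volume {y : EuclideanSpace ℝ (Fin 3) | lam0 * ‖curl (u t) x‖ ≤ ‖curl (u t) y‖ ∧
              ‖x - y‖ ≤ R0 * Real.sqrt (ν / ‖curl (u t) x‖) ∧
              ε < Real.sqrt (1 - (inner ℝ (‖curl (u t) x‖⁻¹ • curl (u t) x)
                (‖curl (u t) y‖⁻¹ • curl (u t) y)) ^ 2)}
            ≤ ENNReal.ofReal (δ * Real.sqrt (ν / ‖curl (u t) x‖) ^ 3) :=
  nearMaxMostTimesBulkAlignment_of_aprioriMostTimesBulkAlignment
    (aprioriMostTimesBulkAlignment_of_universalSomeAlignedWindowLaw_of_typeIIResidue hL hRII)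

/-- **UAW∃ ∧ NoTypeII ⇒ Clay (A)** (`navierStokesRegularity_of_target_of_typeIliouvilleNoTypeII`; the residual in the
route's spelling `Theses.ScaledTopAlignment.NoTypeII`). [folklore] -/
theorem navierStokesRegularity_of_universalSomeAlignedWindowLaw_of_noTypeII
    (hL : ∃ lam0 : ℝ, lam0 < 1 ∧ ∃ R0 : ℝ, 0 < R0 ∧ ∃ θ : ℝ, θ < 1 ∧
      ∀ q : ℝ, 0 < q → ∀ ε : ℝ, 0 < ε → ∀ δ : ℝ, 0 < δ → ∃ A : ℝ, 0 < A ∧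
        ∀ (ν T : ℝ), 0 < ν → 0 < T → ∀ (u : ℝ → EuclideanSpace ℝ (Fin 3) → EuclideanSpace ℝ (Fin 3))
          (p : ℝ → EuclideanSpace ℝ (Fin 3) → ℝ),
          IsClassicalNSSolutionOn (Set.Ico 0 T) ν 0 u p → IsLerayHopfOn T ν 0 (u 0) u → HasRapidSpatialDecay (u 0) →
          ∀ m0 : ℝ, 0 < m0 → (∀ x, ‖curl (u 0) x‖ ≤ m0) →
            ∃ E : Set ℝ, (∃ h0 : ℝ, 0 < h0 ∧ ∀ h : ℝ, 0 < h → h < h0 →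
                volume (E ∩ Set.Ioo (T - h) T) ≤ ENNReal.ofReal (θ * h)) ∧
              ∀ t ∈ Set.Ico 0 T, t ∉ E →
                (∃ x : EuclideanSpace ℝ (Fin 3), A * m0 ≤ ‖curl (u t) x‖ ∧
                  ∀ x' : EuclideanSpace ℝ (Fin 3), q * ‖curl (u t) x'‖ ≤ ‖curl (u t) x‖) →
                ∃ x : EuclideanSpace ℝ (Fin 3), A * m0 ≤ ‖curl (u t) x‖ ∧
                  (∀ x' : EuclideanSpace ℝ (Fin 3), q * ‖curl (u t) x'‖ ≤ ‖curl (u t) x‖) ∧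
                  volume {y : EuclideanSpace ℝ (Fin 3) | lam0 * ‖curl (u t) x‖ ≤ ‖curl (u t) y‖ ∧
                      ‖x - y‖ ≤ R0 * Real.sqrt (ν / ‖curl (u t) x‖) ∧
                      ε < Real.sqrt (1 - (inner ℝ (‖curl (u t) x‖⁻¹ • curl (u t) x)
                        (‖curl (u t) y‖⁻¹ • curl (u t) y)) ^ 2)}
                    ≤ ENNReal.ofReal (δ * Real.sqrt (ν / ‖curl (u t) x‖) ^ 3))
    (hII : Summit.NavierStokesRegularity.NavierStokesRegularity.Theses.ScaledTopAlignment.NoTypeII) :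
    NavierStokesRegularity :=
  navierStokesRegularity_of_target_of_typeIliouvilleNoTypeII
    (threadingFluxTarget_of_universalSomeAlignedWindowLaw hL) hII

/-- **UAW ⇒ UAW∃**: the planner's law (clause at EVERY amplified near-maximal point of a good time) implies the weak
law (clause at SOME such point), so the glue of this file subsumes the LAW-T glue. [folklore] -/
theorem universalSomeAlignedWindowLaw_of_universalAmplifiedWindowAlignment
    (hL : ∃ lam0 : ℝ, lam0 < 1 ∧ ∃ R0 : ℝ, 0 < R0 ∧ ∃ θ : ℝ, θ < 1 ∧
      ∀ q : ℝ, 0 < q → ∀ ε : ℝ, 0 < ε → ∀ δ : ℝ, 0 < δ → ∃ A : ℝ, 0 < A ∧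
        ∀ (ν T : ℝ), 0 < ν → 0 < T → ∀ (u : ℝ → EuclideanSpace ℝ (Fin 3) → EuclideanSpace ℝ (Fin 3))
          (p : ℝ → EuclideanSpace ℝ (Fin 3) → ℝ),
          IsClassicalNSSolutionOn (Set.Ico 0 T) ν 0 u p → IsLerayHopfOn T ν 0 (u 0) u → HasRapidSpatialDecay (u 0) →
          ∀ m0 : ℝ, 0 < m0 → (∀ x, ‖curl (u 0) x‖ ≤ m0) →
            ∃ E : Set ℝ, (∃ h0 : ℝ, 0 < h0 ∧ ∀ h : ℝ, 0 < h → h < h0 →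
                volume (E ∩ Set.Ioo (T - h) T) ≤ ENNReal.ofReal (θ * h)) ∧
              ∀ t ∈ Set.Ico 0 T, t ∉ E → ∀ x : EuclideanSpace ℝ (Fin 3), A * m0 ≤ ‖curl (u t) x‖ →
                (∀ x' : EuclideanSpace ℝ (Fin 3), q * ‖curl (u t) x'‖ ≤ ‖curl (u t) x‖) →
                volume {y : EuclideanSpace ℝ (Fin 3) | lam0 * ‖curl (u t) x‖ ≤ ‖curl (u t) y‖ ∧
                    ‖x - y‖ ≤ R0 * Real.sqrt (ν / ‖curl (u t) x‖) ∧
                    ε < Real.sqrt (1 - (inner ℝ (‖curl (u t) x‖⁻¹ • curl (u t) x)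
                      (‖curl (u t) y‖⁻¹ • curl (u t) y)) ^ 2)}
                  ≤ ENNReal.ofReal (δ * Real.sqrt (ν / ‖curl (u t) x‖) ^ 3)) :
    ∃ lam0 : ℝ, lam0 < 1 ∧ ∃ R0 : ℝ, 0 < R0 ∧ ∃ θ : ℝ, θ < 1 ∧
      ∀ q : ℝ, 0 < q → ∀ ε : ℝ, 0 < ε → ∀ δ : ℝ, 0 < δ → ∃ A : ℝ, 0 < A ∧
        ∀ (ν T : ℝ), 0 < ν → 0 < T → ∀ (u : ℝ → EuclideanSpace ℝ (Fin 3) → EuclideanSpace ℝ (Fin 3))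
          (p : ℝ → EuclideanSpace ℝ (Fin 3) → ℝ),
          IsClassicalNSSolutionOn (Set.Ico 0 T) ν 0 u p → IsLerayHopfOn T ν 0 (u 0) u → HasRapidSpatialDecay (u 0) →
          ∀ m0 : ℝ, 0 < m0 → (∀ x, ‖curl (u 0) x‖ ≤ m0) →
            ∃ E : Set ℝ, (∃ h0 : ℝ, 0 < h0 ∧ ∀ h : ℝ, 0 < h → h < h0 →
                volume (E ∩ Set.Ioo (T - h) T) ≤ ENNReal.ofReal (θ * h)) ∧
              ∀ t ∈ Set.Ico 0 T, t ∉ E →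
                (∃ x : EuclideanSpace ℝ (Fin 3), A * m0 ≤ ‖curl (u t) x‖ ∧
                  ∀ x' : EuclideanSpace ℝ (Fin 3), q * ‖curl (u t) x'‖ ≤ ‖curl (u t) x‖) →
                ∃ x : EuclideanSpace ℝ (Fin 3), A * m0 ≤ ‖curl (u t) x‖ ∧
                  (∀ x' : EuclideanSpace ℝ (Fin 3), q * ‖curl (u t) x'‖ ≤ ‖curl (u t) x‖) ∧
                  volume {y : EuclideanSpace ℝ (Fin 3) | lam0 * ‖curl (u t) x‖ ≤ ‖curl (u t) y‖ ∧
                      ‖x - y‖ ≤ R0 * Real.sqrt (ν / ‖curl (u t) x‖) ∧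
                      ε < Real.sqrt (1 - (inner ℝ (‖curl (u t) x‖⁻¹ • curl (u t) x)
                        (‖curl (u t) y‖⁻¹ • curl (u t) y)) ^ 2)}
                    ≤ ENNReal.ofReal (δ * Real.sqrt (ν / ‖curl (u t) x‖) ^ 3) := by
  obtain ⟨lam0, hlam1, R0, hR0, θ, hθ, hfam⟩ := hL
  refine ⟨lam0, hlam1, R0, hR0, θ, hθ, fun q hq ε hε δ hδ => ?_⟩
  obtain ⟨A, hA, hA'⟩ := hfam q hq ε hε δ hδ
  refine ⟨A, hA, fun ν T hν hT u p hcl hLH hdec m0 hm0 hbd => ?_⟩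
  obtain ⟨E, hE, hgood⟩ := hA' ν T hν hT u p hcl hLH hdec m0 hm0 hbd
  refine ⟨E, hE, fun t ht htE hex => ?_⟩
  obtain ⟨x, hxamp, hxnear⟩ := hex
  exact ⟨x, hxamp, hxnear, hgood t ht htE x hxamp hxnear⟩

end Summit.NavierStokesRegularity.NavierStokesRegularity.Theorems

end
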